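import Literature.Geometry.Symplectic.OrigamiNullFoliation
import Literature.Geometry.Kaehler.ManifoldFormsPullback
import HarnessLib

/-!
# Null vectors of the restriction `j^*ω` to the fold are multiples of the orbit velocity

Proofs companion of `OrigamiUnfolding.lean` (the named fact
`Literature.Geometry.Symplectic.exists_symplecticCutPieces_of_isOrigamiForm`, Cannas da
Silva–Guillemin–Pires, *Symplectic Origami*, IMRN 2011 = arXiv:0909.4065, Prop. 2.8), step (S2):
"Let `ω_B` be the reduced symplectic form on `B`. Then `i^*ω = π^*ω_B`" — for the descended form
`ω_B` to be SYMPLECTIC one needs that the kernel of `i^*ω` at each fold point is exactly the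
orbit line (Def. 2.1: "`i^*ω` has a one-dimensional kernel at each point: the null foliation",
Def. 2.2 / after Def. 2.5: it is the vertical bundle of the null fibration).
`OrigamiNullFoliation.lean` proves the AMBIENT statement `ker ω ∩ TZ = ℝ · X` (as subspaces of
`T_{j n} M`); this file derives the INTRINSIC one on `T_n N`:

* `IsFoldedForm.altKer_sup_span_range_eq_top` — `ker ω + TZ = T_{j n} M` (dimensions
  `2 + 3 - 1 = 4`);
* `IsFoldedForm.mfderiv_mem_altKer_of_null` — **`TZ^{ω} = ker ω`**: if `dj v` is `ω`-orthogonal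
  to `TZ` then `dj v ∈ ker ω` (pair `dj v` against `ker ω + TZ = ℝ⁴`);
* **`IsFoldedForm.exists_eq_smul_of_null`** — for fold data `(N, j, θ)` of an origami form, every
  null vector `v` of `(j^*ω)_n` (`(j^*ω)_n (v, ·) = 0`) is a real multiple of the fundamental
  vector `X_n = d/dt|₀ θ (exp t) n`; and `IsFoldedForm.null_iff_exists_eq_smul` (the converse
  being the tangency clause of `IsOrigamiForm`).

Everything here is proved; no definitions, no facts.

## References

* A. Cannas da Silva, V. Guillemin, A. R. Pires, *Symplectic Origami*, IMRN 2011 =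
  arXiv:0909.4065, Def. 2.1, Def. 2.2, Prop. 2.8. [CannasdasilvaGuilleminPires2010]
-/

noncomputable section

open scoped Manifold ContDiff Topology
open Set Function Module
open Literature.Geometry.Kaehler Literature.Geometry.Manifold

namespace Literature.Geometry.Symplectic

/-! ### Polymorphic helpers for `2`-forms (usable on `TangentSpace`-typed vectors) -/

/-- A `2`-form is antisymmetric. [folklore] -/
private theorem camTwo_swap {V : Type*} [AddCommGroup V] [Module ℝ V] [TopologicalSpace V]
    (α : V [⋀^Fin 2]→L[ℝ] ℝ) (a b : V) : α ![b, a] = -α ![a, b] := by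
  have h := α.map_swap ![a, b] (i := 0) (j := 1) (by decide)
  have hsw : (![a, b] : Fin 2 → V) ∘ Equiv.swap (0 : Fin 2) 1 = ![b, a] := by
    funext k
    fin_cases k <;> rfl
  rw [hsw] at h
  exact h

/-- A `2`-form is additive in its first argument. [folklore] -/
private theorem camTwo_add_left {V : Type*} [AddCommGroup V] [Module ℝ V] [TopologicalSpace V]
    (α : V [⋀^Fin 2]→L[ℝ] ℝ) (a a' b : V) : α ![a + a', b] = α ![a, b] + α ![a', b] :=
  α.vecCons_add ![b] a a'

/-- A `2`-form is homogeneous in its first argument. [folklore] -/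
private theorem camTwo_smul_left {V : Type*} [AddCommGroup V] [Module ℝ V] [TopologicalSpace V]
    (α : V [⋀^Fin 2]→L[ℝ] ℝ) (c : ℝ) (a b : V) : α ![c • a, b] = c * α ![a, b] :=
  α.vecCons_smul ![b] c a

variable {M : Type*} [TopologicalSpace M] [ChartedSpace (EuclideanSpace ℝ (Fin 4)) M]
  [IsManifold (𝓡 4) ∞ M]
  {N : Type} [TopologicalSpace N] [ChartedSpace (EuclideanSpace ℝ (Fin 3)) N]
  [IsManifold (𝓡 3) ∞ N] {j : N → M} {θ : Circle → N → N}

/-- **`ker ω + TZ = T_{j n} M`** along the fold of a folded form: `dim ker ω = 2`, `dim TZ = 3`,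
`dim (ker ω ∩ TZ) = 1`, and `2 + 3 - 1 = 4`. [cite: CannasdasilvaGuilleminPires2010, Def. 2.1] -/
theorem IsFoldedForm.altKer_sup_span_range_eq_top {s : MForm (𝓡 4) M ℝ 2} (h : IsFoldedForm s N j)
    (n : N) :
    altKer (s (j n)) ⊔ (Submodule.span ℝ (Set.range (mfderiv (𝓡 3) (𝓡 4) j n)) :
        Submodule ℝ (EuclideanSpace ℝ (Fin 4))) = ⊤ := by
  set K := altKer (s (j n)) with hK
  set W : Submodule ℝ (EuclideanSpace ℝ (Fin 4)) :=
    Submodule.span ℝ (Set.range (mfderiv (𝓡 3) (𝓡 4) j n)) with hW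
  have hdim := Submodule.finrank_sup_add_finrank_inf_eq K W
  rw [h.finrank_altKer n, h.finrank_span_range_mfderiv n, h.finrank_altKer_inf_range n] at hdim
  have h4 : finrank ℝ ↥(K ⊔ W) = 4 := by omega
  apply Submodule.eq_top_of_finrank_eq
  rw [h4, finrank_euclideanSpace_fin]

/-- **`TZ^{ω} = ker ω` along the fold**: a vector `u ∈ T_{j n} M` which is `ω`-orthogonal to the
whole tangent space of the fold (`ω(u, dj w) = 0` for all `w`) lies in `ker ω` — pair `u`
against `ker ω + TZ = T_{j n} M`. [cite: CannasdasilvaGuilleminPires2010, Def. 2.1] -/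
theorem IsFoldedForm.mem_altKer_of_orth_range {s : MForm (𝓡 4) M ℝ 2} (h : IsFoldedForm s N j)
    (n : N) {u : EuclideanSpace ℝ (Fin 4)}
    (hu : ∀ w : EuclideanSpace ℝ (Fin 3), s (j n) ![u, mfderiv (𝓡 3) (𝓡 4) j n w] = 0) :
    u ∈ altKer (s (j n)) := by
  rw [mem_altKer_iff]
  intro e
  -- `e = κ + w'` with `κ ∈ ker ω`, `w' ∈ TZ = range dj`
  have he : e ∈ altKer (s (j n)) ⊔ (Submodule.span ℝ (Set.range (mfderiv (𝓡 3) (𝓡 4) j n)) :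
      Submodule ℝ (EuclideanSpace ℝ (Fin 4))) := by
    rw [h.altKer_sup_span_range_eq_top n]
    exact Submodule.mem_top
  obtain ⟨κ, hκ, w', hw', rfl⟩ := Submodule.mem_sup.1 he
  have hw'r : w' ∈ LinearMap.range (mfderiv (𝓡 3) (𝓡 4) j n).toLinearMap := by
    rw [← span_range_mfderiv_eq n]
    exact hw'
  obtain ⟨w, rfl⟩ := hw'r
  -- pair `u` against `κ + dj w`
  have hκu : s (j n) ![κ, u] = 0 := (mem_altKer_iff _).1 hκ u
  have hwu : s (j n) ![(mfderiv (𝓡 3) (𝓡 4) j n).toLinearMap w, u] = 0 :=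
    (camTwo_swap (s (j n)) u _).trans (by rw [show s (j n) ![u, (mfderiv (𝓡 3) (𝓡 4) j n).toLinearMap w] = 0 from hu w, neg_zero])
  refine (camTwo_swap (s (j n)) _ u).trans ?_
  refine (congrArg Neg.neg (camTwo_add_left (s (j n)) κ _ u)).trans ?_
  have hκu' : s (j n) ![κ, u] = 0 := hκu
  rw [hκu', hwu, add_zero, neg_zero]

omit [IsManifold (𝓡 4) ∞ M] [IsManifold (𝓡 3) ∞ N] in
/-- The pull-back `(j^*ω)_n (v, w) = ω_{j n} (dj v, dj w)`. [folklore] -/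
theorem pullback_j_apply_two (s : MForm (𝓡 4) M ℝ 2) (n : N) (v w : EuclideanSpace ℝ (Fin 3)) :
    (s.pullback (𝓡 3) j) n ![v, w] = s (j n) ![mfderiv (𝓡 3) (𝓡 4) j n v, mfderiv (𝓡 3) (𝓡 4) j n w] := by
  rw [MForm.pullback_apply]
  congr 1
  funext i
  fin_cases i <;> rfl

/-- If `v` is a null vector of `(j^*ω)_n` then `dj v ∈ ker ω ∩ TZ`.
[cite: CannasdasilvaGuilleminPires2010, Def. 2.1] -/
theorem IsFoldedForm.mfderiv_mem_altKer_of_null {s : MForm (𝓡 4) M ℝ 2} (h : IsFoldedForm s N j)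
    (n : N) {v : EuclideanSpace ℝ (Fin 3)}
    (hnull : ∀ w : EuclideanSpace ℝ (Fin 3), (s.pullback (𝓡 3) j) n ![v, w] = 0) :
    mfderiv (𝓡 3) (𝓡 4) j n v ∈ altKer (s (j n)) :=
  h.mem_altKer_of_orth_range n fun w => by rw [← pullback_j_apply_two]; exact hnull w

/-- **Null vectors of `j^*ω` are multiples of the orbit velocity.** For fold data `(N, j, θ)` of
an origami form (a folded form with a free smooth circle action on the folding hypersurface
whose orbits are tangent to `ker ω`), if `(j^*ω)_n (v, ·) = 0` then `v = c · X_n` for the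
fundamental vector `X_n = d/dt|₀ θ (exp t) n`: `dj v` lies in `ker ω ∩ TZ = ℝ · dj X_n`
(`altKer_inf_span_range_eq_span`) and `dj` is injective.
[cite: CannasdasilvaGuilleminPires2010, Def. 2.2] -/
theorem IsFoldedForm.exists_eq_smul_of_null {s : MForm (𝓡 4) M ℝ 2} (h : IsFoldedForm s N j)
    (hθ : ContMDiff ((𝓡 1).prod (𝓡 3)) (𝓡 3) ∞ (fun p : Circle × N => θ p.1 p.2))
    (h1 : ∀ n, θ 1 n = n) (hmul : ∀ a b n, θ (a * b) n = θ a (θ b n))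
    (hfree : ∀ a n, θ a n = n → a = 1)
    (htan : ∀ (n : N) (w : TangentSpace (𝓡 4) (j n)),
      s (j n) ![mfderiv 𝓘(ℝ, ℝ) (𝓡 4) (fun t : ℝ => j (θ (Circle.exp t) n)) 0 (1 : ℝ), w] = 0)
    (n : N) {v : EuclideanSpace ℝ (Fin 3)}
    (hnull : ∀ w : EuclideanSpace ℝ (Fin 3), (s.pullback (𝓡 3) j) n ![v, w] = 0) :
    ∃ c : ℝ, v = c • (mfderiv 𝓘(ℝ, ℝ) (𝓡 3) (fun t : ℝ => θ (Circle.exp t) n) 0 (1 : ℝ) :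
      EuclideanSpace ℝ (Fin 3)) := by
  set XN : EuclideanSpace ℝ (Fin 3) :=
    mfderiv 𝓘(ℝ, ℝ) (𝓡 3) (fun t : ℝ => θ (Circle.exp t) n) 0 (1 : ℝ) with hXN
  set X : EuclideanSpace ℝ (Fin 4) :=
    mfderiv 𝓘(ℝ, ℝ) (𝓡 4) (fun t : ℝ => j (θ (Circle.exp t) n)) 0 (1 : ℝ) with hX
  have hXeq : X = mfderiv (𝓡 3) (𝓡 4) j n XN :=
    mfderiv_comp_circleOrbit_apply h.embedding.contMDiff hθ h1 n
  -- `dj v ∈ ker ω ∩ TZ = ℝ · X`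
  have hmemK := h.mfderiv_mem_altKer_of_null n hnull
  have hmemW : mfderiv (𝓡 3) (𝓡 4) j n v ∈ (Submodule.span ℝ (Set.range (mfderiv (𝓡 3) (𝓡 4) j n)) :
      Submodule ℝ (EuclideanSpace ℝ (Fin 4))) :=
    Submodule.subset_span ⟨v, rfl⟩
  have hmem : mfderiv (𝓡 3) (𝓡 4) j n v ∈
      altKer (s (j n)) ⊓ (Submodule.span ℝ (Set.range (mfderiv (𝓡 3) (𝓡 4) j n)) :
        Submodule ℝ (EuclideanSpace ℝ (Fin 4))) := ⟨hmemK, hmemW⟩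
  rw [h.altKer_inf_span_range_eq_span hθ h1 hmul hfree htan n] at hmem
  have hmem' : (mfderiv (𝓡 3) (𝓡 4) j n v : EuclideanSpace ℝ (Fin 4)) ∈ (ℝ ∙ X) := hmem
  obtain ⟨c, hc⟩ := (Submodule.mem_span_singleton (R := ℝ) (M := EuclideanSpace ℝ (Fin 4))
    (x := (mfderiv (𝓡 3) (𝓡 4) j n v : EuclideanSpace ℝ (Fin 4))) (y := X)).1 hmem'
  refine ⟨c, ?_⟩
  have hinj : Injective (mfderiv (𝓡 3) (𝓡 4) j n) :=
    Literature.Topology.FourManifolds.Manifold.IsImmersionAt.mfderiv_injective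
      (h.embedding.isImmersion.isImmersionAt n) (by simp)
  apply hinj
  show (mfderiv (𝓡 3) (𝓡 4) j n v : EuclideanSpace ℝ (Fin 4)) = mfderiv (𝓡 3) (𝓡 4) j n (c • XN)
  rw [← hc, hXeq]
  exact (map_smul (mfderiv (𝓡 3) (𝓡 4) j n) c XN).symm

omit [IsManifold (𝓡 4) ∞ M] [IsManifold (𝓡 3) ∞ N] in
/-- The orbit velocity is a null vector of `j^*ω` (the tangency clause read intrinsically).
[cite: CannasdasilvaGuilleminPires2010, Def. 2.2] -/
theorem IsFoldedForm.null_orbitVelocity {s : MForm (𝓡 4) M ℝ 2} (h : IsFoldedForm s N j)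
    (hθ : ContMDiff ((𝓡 1).prod (𝓡 3)) (𝓡 3) ∞ (fun p : Circle × N => θ p.1 p.2))
    (h1 : ∀ n, θ 1 n = n)
    (htan : ∀ (n : N) (w : TangentSpace (𝓡 4) (j n)),
      s (j n) ![mfderiv 𝓘(ℝ, ℝ) (𝓡 4) (fun t : ℝ => j (θ (Circle.exp t) n)) 0 (1 : ℝ), w] = 0)
    (n : N) (w : EuclideanSpace ℝ (Fin 3)) :
    (s.pullback (𝓡 3) j) n
      ![(mfderiv 𝓘(ℝ, ℝ) (𝓡 3) (fun t : ℝ => θ (Circle.exp t) n) 0 (1 : ℝ) :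
        EuclideanSpace ℝ (Fin 3)), w] = 0 := by
  rw [pullback_j_apply_two, ← mfderiv_comp_circleOrbit_apply h.embedding.contMDiff hθ h1 n]
  exact htan n _

/-- **The kernel of `(j^*ω)_n` is exactly the orbit line.** [cite: CannasdasilvaGuilleminPires2010, Def. 2.2] -/
theorem IsFoldedForm.null_iff_exists_eq_smul {s : MForm (𝓡 4) M ℝ 2} (h : IsFoldedForm s N j)
    (hθ : ContMDiff ((𝓡 1).prod (𝓡 3)) (𝓡 3) ∞ (fun p : Circle × N => θ p.1 p.2))
    (h1 : ∀ n, θ 1 n = n) (hmul : ∀ a b n, θ (a * b) n = θ a (θ b n))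
    (hfree : ∀ a n, θ a n = n → a = 1)
    (htan : ∀ (n : N) (w : TangentSpace (𝓡 4) (j n)),
      s (j n) ![mfderiv 𝓘(ℝ, ℝ) (𝓡 4) (fun t : ℝ => j (θ (Circle.exp t) n)) 0 (1 : ℝ), w] = 0)
    (n : N) (v : EuclideanSpace ℝ (Fin 3)) :
    (∀ w : EuclideanSpace ℝ (Fin 3), (s.pullback (𝓡 3) j) n ![v, w] = 0) ↔
      ∃ c : ℝ, v = c • (mfderiv 𝓘(ℝ, ℝ) (𝓡 3) (fun t : ℝ => θ (Circle.exp t) n) 0 (1 : ℝ) :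
        EuclideanSpace ℝ (Fin 3)) := by
  refine ⟨h.exists_eq_smul_of_null hθ h1 hmul hfree htan n, ?_⟩
  rintro ⟨c, rfl⟩ w
  rw [pullback_j_apply_two]
  refine ((congrArg (fun z => s (j n) ![z, mfderiv (𝓡 3) (𝓡 4) j n w])
    (map_smul (mfderiv (𝓡 3) (𝓡 4) j n) c _)).trans ?_)
  refine (camTwo_smul_left (s (j n)) c _ _).trans ?_
  have h0 : s (j n) ![mfderiv (𝓡 3) (𝓡 4) j n
      (mfderiv 𝓘(ℝ, ℝ) (𝓡 3) (fun t : ℝ => θ (Circle.exp t) n) 0 (1 : ℝ)),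
      mfderiv (𝓡 3) (𝓡 4) j n w] = 0 := by
    rw [← mfderiv_comp_circleOrbit_apply h.embedding.contMDiff hθ h1 n]
    exact htan n _
  rw [h0, mul_zero]

end Literature.Geometry.Symplectic

end
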